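import Summits.RiemannHypothesis.RiemannHypothesis.Theorems.IntegerScrewScrewPolyFloorLandauHelson
import Mathlib.Analysis.PSeries
import HarnessLib

/-!
# Route IntegerScrew — bilinear sums over the ratios `m/m'` (elementary estimates)

Helper file for crux `IntegerScrew.ScrewPolyFloor` (stmt-RiemannHypothesis-15757): the elementary
real inequalities by which the entrywise error of Landau's formula at `x = m/m'`
(`LandauGonek.landau_gonek_formula_sharp`: `x²(1 + 1/log x)² log²T + x² log 3x + log(3x) min(T, x/⟨x⟩)`)
is summed against `|y_m| |y_m'|` with a loss `O(M^{5/2})` instead of the `O(M⁵)` of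
`pairing_window_lower_bound`:

* `inv_log_div_le_div` — `1/log(m/m') ≤ m/(m − m')`; `sq_div_log_sq_le` —
  `(m/m')²/log²(m/m') ≤ 4(m/m')² + 4m²/(m − m')²`;
* `sum_inv_pow_four_le_two` — `∑_{m ≤ M} 1/m⁴ ≤ 2` (and `∑ 1/m² ≤ 2`, Mathlib's `sum_Ioo_inv_sq_le`);
* `sum_abs_mul_sum_abs_div_sq_le` — `(∑|y_m|)(∑|y_m'|/m'²) ≤ √(2M) ∑ y_m²` (Cauchy–Schwarz twice);
* `sum_ne_inv_sub_sq_le_four` — `∑_{m' ≤ M, m' ≠ m} 1/(m − m')² ≤ 4`;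
* `bilinear_inv_sub_sq_le` — `∑_{m ≠ m'} |y_m||y_m'|/(m − m')² ≤ 4 ∑ y_m²` (Schur / AM–GM).
-/

noncomputable section

open Finset
open scoped Real

-- the layout-mandated namespace repeats the summit name
set_option linter.dupNamespace false

namespace Summit.RiemannHypothesis.RiemannHypothesis.Theorems.IntegerScrewLandau

/-! ### The ratio `x = m/m'` near `1` -/

/-- `1/log(m/m') ≤ m/(m − m')` for `1 ≤ m' < m` (`log x ≥ 1 − 1/x`). [folklore] -/
theorem inv_log_div_le_div {m m' : ℕ} (hm' : 1 ≤ m') (hlt : m' < m) :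
    1 / Real.log ((m : ℝ) / m') ≤ (m : ℝ) / ((m : ℝ) - m') := by
  have hm0 : (0 : ℝ) < m := Nat.cast_pos.2 (lt_of_lt_of_le (Nat.lt_of_succ_le hm') hlt.le)
  have hm'0 : (0 : ℝ) < m' := by exact_mod_cast hm'
  have h1 : (1 : ℝ) ≤ (m : ℝ) - m' := by
    have : (m' : ℝ) + 1 ≤ m := by exact_mod_cast hlt
    linarith
  have hlog : ((m : ℝ) - m') / m ≤ Real.log ((m : ℝ) / m') := by
    have h := Real.one_sub_inv_le_log_of_pos (div_pos hm0 hm'0)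
    rw [inv_div] at h
    have e : 1 - (m' : ℝ) / m = ((m : ℝ) - m') / m := by field_simp
    rwa [e] at h
  have hpos : 0 < ((m : ℝ) - m') / m := by positivity
  calc 1 / Real.log ((m : ℝ) / m') ≤ 1 / (((m : ℝ) - m') / m) := one_div_le_one_div_of_le hpos hlog
    _ = m / ((m : ℝ) - m') := by rw [one_div_div]

/-- `(m/m')²/log²(m/m') ≤ 4 (m/m')² + 4 m²/(m − m')²` for `1 ≤ m' < m`: if `m' ≤ m/2` then
`log(m/m') ≥ log 2 ≥ 1/2`, else `m/m' < 2` and `1/log(m/m') ≤ m/(m−m')`. [folklore] -/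
theorem sq_div_log_sq_le {m m' : ℕ} (hm' : 1 ≤ m') (hlt : m' < m) :
    ((m : ℝ) / m') ^ 2 / Real.log ((m : ℝ) / m') ^ 2 ≤
      4 * ((m : ℝ) / m') ^ 2 + 4 * ((m : ℝ) ^ 2 / ((m : ℝ) - m') ^ 2) := by
  have hm0 : (0 : ℝ) < m := Nat.cast_pos.2 (lt_of_lt_of_le (Nat.lt_of_succ_le hm') hlt.le)
  have hm'0 : (0 : ℝ) < m' := by exact_mod_cast hm'
  have hmm' : (m' : ℝ) < m := by exact_mod_cast hlt
  set x : ℝ := (m : ℝ) / m' with hx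
  have hx1 : 1 < x := by rw [hx, one_lt_div hm'0]; exact hmm'
  have hx0 : 0 < x := by linarith
  have hL0 : 0 < Real.log x := Real.log_pos hx1
  have hsub0 : 0 < (m : ℝ) - m' := by linarith
  have hA : 0 ≤ 4 * x ^ 2 := by positivity
  have hB : 0 ≤ 4 * ((m : ℝ) ^ 2 / ((m : ℝ) - m') ^ 2) := by positivity
  rcases le_or_gt (2 * (m' : ℝ)) m with hfar | hnear
  · -- `m' ≤ m/2`: `log x ≥ log 2 > 1/2`
    have h2 : 2 ≤ x := by rw [hx, le_div_iff₀ hm'0]; linarith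
    have hlog2 : (1 / 2 : ℝ) < Real.log x := by
      have := Real.log_two_gt_d9
      have h := Real.log_le_log two_pos h2
      linarith
    have hL2 : 1 / 4 ≤ Real.log x ^ 2 := by nlinarith
    calc x ^ 2 / Real.log x ^ 2 ≤ x ^ 2 / (1 / 4) := div_le_div_of_nonneg_left (sq_nonneg _) (by norm_num) hL2
      _ = 4 * x ^ 2 := by ring
      _ ≤ 4 * x ^ 2 + 4 * ((m : ℝ) ^ 2 / ((m : ℝ) - m') ^ 2) := le_add_of_nonneg_right hB
  · -- `m' > m/2`: `x < 2` and `1/log x ≤ m/(m − m')`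
    have hx2 : x < 2 := by rw [hx, div_lt_iff₀ hm'0]; linarith
    have hxsq : x ^ 2 ≤ 4 := by nlinarith
    have hinv := inv_log_div_le_div hm' hlt
    rw [← hx] at hinv
    have hinv0 : 0 ≤ 1 / Real.log x := by positivity
    have hinv2 : (1 / Real.log x) ^ 2 ≤ ((m : ℝ) / ((m : ℝ) - m')) ^ 2 :=
      pow_le_pow_left₀ hinv0 hinv 2
    calc x ^ 2 / Real.log x ^ 2 = x ^ 2 * (1 / Real.log x) ^ 2 := by rw [one_div_pow]; ring
      _ ≤ 4 * ((m : ℝ) / ((m : ℝ) - m')) ^ 2 :=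
          mul_le_mul hxsq hinv2 (sq_nonneg _) (by norm_num)
      _ = 4 * ((m : ℝ) ^ 2 / ((m : ℝ) - m') ^ 2) := by rw [div_pow]
      _ ≤ 4 * x ^ 2 + 4 * ((m : ℝ) ^ 2 / ((m : ℝ) - m') ^ 2) := le_add_of_nonneg_left hA

/-! ### `∑ 1/m² ≤ 2`, `∑ 1/m⁴ ≤ 2` -/

/-- `∑_{1 ≤ m ≤ M} 1/m⁴ ≤ 2` (`1/m⁴ ≤ 1/m²` and Mathlib's `sum_Ioo_inv_sq_le`; the bound
`∑_{m ≤ M} 1/m² ≤ 2` is `SieveIntervalSystem.sum_Icc_inv_sq_le_two` in the tree, re-derived inline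
here to keep the import closure small). [folklore] -/
theorem sum_inv_pow_four_le_two (M : ℕ) : ∑ m ∈ Icc 1 M, 1 / (m : ℝ) ^ 4 ≤ 2 := by
  have hsq : ∑ m ∈ Icc 1 M, 1 / (m : ℝ) ^ 2 ≤ 2 := by
    have h := sum_Ioo_inv_sq_le (α := ℝ) 0 (M + 1)
    have e : Icc 1 M = Ioo 0 (M + 1) := by
      ext m; simp only [Finset.mem_Icc, Finset.mem_Ioo]; omega
    rw [e]
    simp only [one_div]
    norm_num at h
    exact h
  refine le_trans (Finset.sum_le_sum fun m hm ↦ ?_) hsq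
  rw [Finset.mem_Icc] at hm
  have hm1 : (1 : ℝ) ≤ m := by exact_mod_cast hm.1
  have hm0 : (0 : ℝ) < m := by linarith
  rw [div_le_div_iff₀ (by positivity) (by positivity), one_mul, one_mul]
  calc (m : ℝ) ^ 2 = (m : ℝ) ^ 2 * 1 := by ring
    _ ≤ (m : ℝ) ^ 2 * (m : ℝ) ^ 2 := by gcongr; nlinarith
    _ = (m : ℝ) ^ 4 := by ring

/-! ### Cauchy–Schwarz for the far pairs -/

/-- `(∑_{m ≤ M} |y_m|)(∑_{m' ≤ M} |y_m'|/m'²) ≤ √(2M) ∑ y_m²`: `(∑|y_m|)² ≤ M ∑y²` and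
`(∑|y_m'|/m'²)² ≤ (∑ 1/m'⁴) ∑y² ≤ 2 ∑y²`. [folklore] -/
theorem sum_abs_mul_sum_abs_div_sq_le (M : ℕ) (y : ℕ → ℝ) :
    (∑ m ∈ Icc 1 M, |y m|) * (∑ m ∈ Icc 1 M, |y m| / (m : ℝ) ^ 2) ≤
      Real.sqrt (2 * M) * ∑ m ∈ Icc 1 M, y m ^ 2 := by
  set A : ℝ := ∑ m ∈ Icc 1 M, |y m| with hA
  set B : ℝ := ∑ m ∈ Icc 1 M, |y m| / (m : ℝ) ^ 2 with hB
  set S : ℝ := ∑ m ∈ Icc 1 M, y m ^ 2 with hS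
  have hA0 : 0 ≤ A := Finset.sum_nonneg fun _ _ ↦ abs_nonneg _
  have hB0 : 0 ≤ B := Finset.sum_nonneg fun _ _ ↦ by positivity
  have hS0 : 0 ≤ S := Finset.sum_nonneg fun _ _ ↦ sq_nonneg _
  have hA2 : A ^ 2 ≤ M * S := sq_sum_abs_le M y
  have hB2 : B ^ 2 ≤ 2 * S := by
    have h := Finset.sum_mul_sq_le_sq_mul_sq (Icc 1 M) (fun m ↦ 1 / (m : ℝ) ^ 2) (fun m ↦ |y m|)
    have e1 : ∑ m ∈ Icc 1 M, 1 / (m : ℝ) ^ 2 * |y m| = B := by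
      rw [hB]; exact Finset.sum_congr rfl fun m _ ↦ by ring
    have e2 : ∑ m ∈ Icc 1 M, |y m| ^ 2 = S := by
      rw [hS]; exact Finset.sum_congr rfl fun m _ ↦ sq_abs _
    have e3 : ∑ m ∈ Icc 1 M, (1 / (m : ℝ) ^ 2) ^ 2 = ∑ m ∈ Icc 1 M, 1 / (m : ℝ) ^ 4 :=
      Finset.sum_congr rfl fun m _ ↦ by rw [one_div_pow, ← pow_mul]
    rw [e1, e2, e3] at h
    calc B ^ 2 ≤ (∑ m ∈ Icc 1 M, 1 / (m : ℝ) ^ 4) * S := h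
      _ ≤ 2 * S := mul_le_mul_of_nonneg_right (sum_inv_pow_four_le_two M) hS0
  have hAB : (A * B) ^ 2 ≤ 2 * M * S ^ 2 := by
    calc (A * B) ^ 2 = A ^ 2 * B ^ 2 := by ring
      _ ≤ (M * S) * (2 * S) := mul_le_mul hA2 hB2 (sq_nonneg _) (by positivity)
      _ = 2 * M * S ^ 2 := by ring
  have hAB0 : 0 ≤ A * B := mul_nonneg hA0 hB0
  calc A * B ≤ Real.sqrt (2 * M * S ^ 2) := Real.le_sqrt_of_sq_le hAB
    _ = Real.sqrt (2 * M) * S := by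
        rw [Real.sqrt_mul (by positivity), Real.sqrt_sq hS0]

/-! ### Schur's bound for the near-diagonal pairs -/

/-- `∑_{m' ≤ M, m' < m} 1/(m − m')² ≤ 2` (reindex by `k = m − m'`). [folklore] -/
theorem sum_lt_inv_sub_sq_le_two (M m : ℕ) :
    ∑ m' ∈ (Icc 1 M).filter (fun m' ↦ m' < m), 1 / ((m : ℝ) - m') ^ 2 ≤ 2 := by
  classical
  set A := (Icc 1 M).filter (fun m' ↦ m' < m) with hA
  have hinj : Set.InjOn (fun m' : ℕ ↦ m - m') A := by
    intro a ha b hb hab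
    simp only [hA, Finset.coe_filter, Set.mem_setOf_eq, Finset.mem_Icc] at ha hb
    simp only at hab
    omega
  have himage : A.image (fun m' ↦ m - m') ⊆ Ioo 0 (m + 1) := by
    intro k hk
    rw [Finset.mem_image] at hk
    obtain ⟨m', hm', rfl⟩ := hk
    simp only [hA, Finset.mem_filter, Finset.mem_Icc] at hm'
    rw [Finset.mem_Ioo]
    omega
  have hsum : ∑ m' ∈ A, 1 / ((m : ℝ) - m') ^ 2 = ∑ k ∈ A.image (fun m' ↦ m - m'), 1 / (k : ℝ) ^ 2 := by
    rw [Finset.sum_image hinj]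
    refine Finset.sum_congr rfl fun m' hm' ↦ ?_
    simp only [hA, Finset.mem_filter, Finset.mem_Icc] at hm'
    rw [Nat.cast_sub hm'.2.le]
  rw [hsum]
  refine le_trans (Finset.sum_le_sum_of_subset_of_nonneg himage fun k _ _ ↦ by positivity) ?_
  have h := sum_Ioo_inv_sq_le (α := ℝ) 0 (m + 1)
  simp only [one_div]
  norm_num at h
  exact h

/-- `∑_{m' ≤ M, m < m'} 1/(m − m')² ≤ 2` (reindex by `k = m' − m`). [folklore] -/
theorem sum_gt_inv_sub_sq_le_two (M m : ℕ) :
    ∑ m' ∈ (Icc 1 M).filter (fun m' ↦ m < m'), 1 / ((m : ℝ) - m') ^ 2 ≤ 2 := by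
  classical
  set A := (Icc 1 M).filter (fun m' ↦ m < m') with hA
  have hinj : Set.InjOn (fun m' : ℕ ↦ m' - m) A := by
    intro a ha b hb hab
    simp only [hA, Finset.coe_filter, Set.mem_setOf_eq, Finset.mem_Icc] at ha hb
    simp only at hab
    omega
  have himage : A.image (fun m' ↦ m' - m) ⊆ Ioo 0 (M + 1) := by
    intro k hk
    rw [Finset.mem_image] at hk
    obtain ⟨m', hm', rfl⟩ := hk
    simp only [hA, Finset.mem_filter, Finset.mem_Icc] at hm'
    rw [Finset.mem_Ioo]
    omega
  have hsum : ∑ m' ∈ A, 1 / ((m : ℝ) - m') ^ 2 = ∑ k ∈ A.image (fun m' ↦ m' - m), 1 / (k : ℝ) ^ 2 := by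
    rw [Finset.sum_image hinj]
    refine Finset.sum_congr rfl fun m' hm' ↦ ?_
    simp only [hA, Finset.mem_filter, Finset.mem_Icc] at hm'
    rw [Nat.cast_sub hm'.2.le]
    ring
  rw [hsum]
  refine le_trans (Finset.sum_le_sum_of_subset_of_nonneg himage fun k _ _ ↦ by positivity) ?_
  have h := sum_Ioo_inv_sq_le (α := ℝ) 0 (M + 1)
  simp only [one_div]
  norm_num at h
  exact h

/-- **Row sums.** `∑_{m' ≤ M, m' ≠ m} 1/(m − m')² ≤ 4`. [folklore] -/
theorem sum_ne_inv_sub_sq_le_four (M m : ℕ) :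
    ∑ m' ∈ Icc 1 M, (if m' = m then 0 else 1 / ((m : ℝ) - m') ^ 2) ≤ 4 := by
  classical
  have hsplit : ∑ m' ∈ Icc 1 M, (if m' = m then 0 else 1 / ((m : ℝ) - m') ^ 2) =
      ∑ m' ∈ (Icc 1 M).filter (fun m' ↦ m' < m), 1 / ((m : ℝ) - m') ^ 2 +
        ∑ m' ∈ (Icc 1 M).filter (fun m' ↦ m < m'), 1 / ((m : ℝ) - m') ^ 2 := by
    rw [Finset.sum_filter, Finset.sum_filter, ← Finset.sum_add_distrib]
    refine Finset.sum_congr rfl fun m' _ ↦ ?_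
    rcases lt_trichotomy m' m with h | h | h
    · simp [h, h.ne, not_lt.2 h.le]
    · simp [h]
    · simp [h, h.ne', not_lt.2 h.le]
  rw [hsplit]
  linarith [sum_lt_inv_sub_sq_le_two M m, sum_gt_inv_sub_sq_le_two M m]

/-- **Schur's bound for the near-diagonal kernel.**
`∑_{m, m' ≤ M, m ≠ m'} |y_m| |y_m'|/(m − m')² ≤ 4 ∑ y_m²` (`|ab| ≤ (a² + b²)/2` and row sums `≤ 4`).
[folklore] -/
theorem bilinear_inv_sub_sq_le :
    ∀ (M : ℕ) (y : ℕ → ℝ), ∑ m ∈ Icc 1 M, ∑ m' ∈ Icc 1 M,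
        |y m| * |y m'| * (if m' = m then 0 else 1 / ((m : ℝ) - m') ^ 2) ≤
      4 * ∑ m ∈ Icc 1 M, y m ^ 2 := by
  intro M y
  classical
  set K : ℕ → ℕ → ℝ := fun m m' ↦ if m' = m then 0 else 1 / ((m : ℝ) - m') ^ 2 with hK
  have hK0 : ∀ m m', 0 ≤ K m m' := fun m m' ↦ by
    simp only [hK]; split_ifs <;> positivity
  have hKsymm : ∀ m m', K m m' = K m' m := fun m m' ↦ by
    simp only [hK]
    by_cases h : m' = m
    · simp [h]
    · rw [if_neg h, if_neg (Ne.symm h), ← neg_sub, neg_sq]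
  -- AM–GM termwise
  have hterm : ∀ m m', |y m| * |y m'| * K m m' ≤ (y m ^ 2 * K m m' + y m' ^ 2 * K m m') / 2 := by
    intro m m'
    have h := hK0 m m'
    have hamgm : |y m| * |y m'| ≤ (y m ^ 2 + y m' ^ 2) / 2 := by
      have := sq_nonneg (|y m| - |y m'|)
      rw [← sq_abs (y m), ← sq_abs (y m')]
      nlinarith
    calc |y m| * |y m'| * K m m' ≤ (y m ^ 2 + y m' ^ 2) / 2 * K m m' :=
          mul_le_mul_of_nonneg_right hamgm h
      _ = (y m ^ 2 * K m m' + y m' ^ 2 * K m m') / 2 := by ring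
  have hrow : ∀ m, ∑ m' ∈ Icc 1 M, K m m' ≤ 4 := fun m ↦ sum_ne_inv_sub_sq_le_four M m
  calc ∑ m ∈ Icc 1 M, ∑ m' ∈ Icc 1 M, |y m| * |y m'| * K m m'
      ≤ ∑ m ∈ Icc 1 M, ∑ m' ∈ Icc 1 M, (y m ^ 2 * K m m' + y m' ^ 2 * K m m') / 2 :=
        Finset.sum_le_sum fun m _ ↦ Finset.sum_le_sum fun m' _ ↦ hterm m m'
    _ = (∑ m ∈ Icc 1 M, y m ^ 2 * ∑ m' ∈ Icc 1 M, K m m') / 2 +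
          (∑ m' ∈ Icc 1 M, y m' ^ 2 * ∑ m ∈ Icc 1 M, K m m') / 2 := by
        simp only [Finset.sum_div, Finset.sum_add_distrib, add_div, Finset.mul_sum]
        rw [Finset.sum_comm (f := fun m m' ↦ y m' ^ 2 * K m m' / 2)]
    _ ≤ (∑ m ∈ Icc 1 M, y m ^ 2 * 4) / 2 + (∑ m' ∈ Icc 1 M, y m' ^ 2 * 4) / 2 := by
        gcongr with m hm m' hm'
        · exact hrow m
        · calc ∑ m ∈ Icc 1 M, K m m' = ∑ m ∈ Icc 1 M, K m' m := Finset.sum_congr rfl fun m _ ↦ hKsymm m m'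
            _ ≤ 4 := hrow m'
    _ = 4 * ∑ m ∈ Icc 1 M, y m ^ 2 := by rw [← Finset.sum_mul]; ring

end Summit.RiemannHypothesis.RiemannHypothesis.Theorems.IntegerScrewLandau

end
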